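import Mathlib
import Summits.MatrixMultiplication.MatrixMultiplication.Theses.SnSubsetDichotomy
import Literature.RepresentationTheory.FiniteGroups.KLRGradedCellularBasis
import Summits.MatrixMultiplication.MatrixMultiplication.Theorems.SnSubsetDichotomyNoThresholdSubsetTriplePairWindow
import Summits.MatrixMultiplication.MatrixMultiplication.Theorems.SnSubsetDichotomyNoThresholdSubsetTriplePairWindowOfDeviation
import Summits.MatrixMultiplication.MatrixMultiplication.Theorems.SnSubsetDichotomyNoThresholdSubsetTriplePairDeviationOfMgf
import Summits.MatrixMultiplication.MatrixMultiplication.Theorems.SnSubsetDichotomyNoThresholdSubsetTriplePairDeviationOfMoments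

/-!
# `SnSubsetDichotomy.NoThresholdSubsetTriple`, line `klr-graded-polynomial-method`:
# the crux from K3 and ANY ONE of the probabilistic forms (deviation / MGF / moments)

Crux `NoThresholdSubsetTriple` (stmt-MatrixMultiplication-8302): every TPP triple `S, T, U ⊆ S_n`
has `|S||T||U| ≤ (n!)^{3/2}·e^{-c√n}` for large `n`. The KLR graded polynomial method reduces it,
given the named Literature fact K3 = `KLRGradedCellularBasis` (the Hu–Mathas graded block basis
of `𝔽₂[S_n]` indexed by `TableauPair n`), to a concentration statement for the degree
`X = deg₂ S + deg₂ T` of a uniformly random same-shape pair `(μ, S, T)` around the `2`-weight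
`w = c₀ − (c₀ − c₁)²` of its shape (standard deviation `≈ 0.72·n^{3/4}`, needed deviation
`≍ n`, i.e. a moderate deviation at speed `√n`). This file records, as one-line compositions of
four landed bridges, the three forms of that statement a proof would naturally deliver:

* DEVIATION form — `#{(μ,S,T) : n ≤ 100·|X − w|} ≤ n!·e^{-c√n}` for large `n`
  (`noThresholdSubsetTriple_of_klr_pairDeviation`; via `pairWindow_of_pairDeviation`, which uses
  the small-`2`-weight exclusion `smallWeightTail`, and `noThresholdSubsetTriple_of_klr_pairWindow`
  = K1 `stub_gradedCodim` with the cut `⌈2w/3⌉` + the transfer `stub_savingTransfer`);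
* MGF form — `∑ (e^{θ(X−w)/√n} + e^{-θ(X−w)/√n}) ≤ 2·n!·e^{Cθ²√n}` for all `0 < θ ≤ θ₀` and large
  `n` (`noThresholdSubsetTriple_of_klr_mgf`; Chernoff, `pairDeviation_of_mgf`) — the form a
  cumulant / free-energy computation of `∑_λ q^{-w}(dim_q S^λ)² = ‖(f₀+f₁)^n v_{Λ₀}‖²_{q^{-D}}`
  at `q = e^{θ/√n}` would give;
* MOMENT form — `∑ (X − w)^{2k} ≤ n!·(Ck)^k·√n^{3k}` for all `1 ≤ k`, `k² ≤ n` and large `n`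
  (`noThresholdSubsetTriple_of_klr_moments`; Markov at `k ≍ √n`, `pairDeviation_of_moments`) —
  the form the method of moments / cumulants (Statulevičius-type bounds
  `|κ_j(X − w)| ≤ j!·C^j·n^{(j+1)/2}`) would give; its fixed-`k` truncations are the "moment
  line" towards `PolynomialSlack` (stmt-MatrixMultiplication-8306).

Together with `noThresholdSubsetTriple_of_klr_swPairsMDP` (J′, the registered open stub, a
one-sided boxed tail of the signed SW/NE pair count) these are four interchangeable sufficient
inputs; none is proved — each is a speed-`√n` moderate-deviation statement for the KLR degree of
Plancherel-random tableaux, open (see `Cruxes/NoThresholdSubsetTriple/Lines/`).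
-/

namespace Summit.MatrixMultiplication.MatrixMultiplication.Theorems

open Literature.RepresentationTheory.FiniteGroups (TableauPair KLRGradedCellularBasis residueContent tableauDegree)
open scoped BigOperators

set_option linter.dupNamespace false in -- deliberate Summit.<S>.<P> duplicate
/-- **K3 ∧ DEVIATION ⟹ crux.** If `𝔽_p[S_n]` has the Hu–Mathas graded block basis
(`KLRGradedCellularBasis`) and the same-shape pairs `(μ, S, T)` with
`n ≤ 100·|deg₂ S + deg₂ T − w(μ)|` (`w = c₀ − (c₀ − c₁)²` the `2`-weight) number at most
`n!·e^{-c√n}` for some `c > 0` and all large `n`, then `NoThresholdSubsetTriple` holds.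
Composition of the landed bridges `pairWindow_of_pairDeviation` (deviation ⟹ window, via
`smallWeightTail`) and `noThresholdSubsetTriple_of_klr_pairWindow` (K1 + transfer). [folklore] -/
theorem noThresholdSubsetTriple_of_klr_pairDeviation : Literature.RepresentationTheory.FiniteGroups.KLRGradedCellularBasis → (∃ c : ℝ, 0 < c ∧ ∃ n₀ : ℕ, ∀ n ≥ n₀, (Nat.card {i : TableauPair n // (n : ℤ) ≤ 100 * |TableauPair.degree 2 i - ((TableauPair.content 2 i 0 : ℤ) - ((TableauPair.content 2 i 0 : ℤ) - (TableauPair.content 2 i 1 : ℤ)) ^ 2)|} : ℝ) ≤ (n.factorial : ℝ) * Real.exp (-(c * Real.sqrt (n : ℝ)))) → Summit.MatrixMultiplication.MatrixMultiplication.Theses.SnSubsetDichotomy.NoThresholdSubsetTriple :=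
  fun hK hD => noThresholdSubsetTriple_of_klr_pairWindow hK (pairWindow_of_pairDeviation hD)

set_option linter.dupNamespace false in -- deliberate Summit.<S>.<P> duplicate
/-- **K3 ∧ MGF ⟹ crux.** If `𝔽_p[S_n]` has the Hu–Mathas graded block basis and the two-sided
moment generating function of `X − w` (`X = deg₂ S + deg₂ T`, `w` the `2`-weight) over the
same-shape pairs satisfies `∑ (e^{θ(X−w)/√n} + e^{-θ(X−w)/√n}) ≤ 2·n!·e^{Cθ²√n}` for every
`0 < θ ≤ θ₀` and all large `n` (a quadratic bound on the normalised log-MGF at the scale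
`θ/√n`), then `NoThresholdSubsetTriple` holds. Composition of `pairDeviation_of_mgf` (Chernoff)
with `noThresholdSubsetTriple_of_klr_pairDeviation`. [folklore] -/
theorem noThresholdSubsetTriple_of_klr_mgf : Literature.RepresentationTheory.FiniteGroups.KLRGradedCellularBasis → (∃ C : ℝ, ∃ θ₀ : ℝ, 0 < θ₀ ∧ ∀ θ : ℝ, 0 < θ → θ ≤ θ₀ → ∃ n₀ : ℕ, ∀ n ≥ n₀, ∑ i : TableauPair n, (Real.exp (θ * ((TableauPair.degree 2 i - ((TableauPair.content 2 i 0 : ℤ) - ((TableauPair.content 2 i 0 : ℤ) - (TableauPair.content 2 i 1 : ℤ)) ^ 2) : ℤ) : ℝ) / Real.sqrt (n : ℝ)) + Real.exp (-(θ * ((TableauPair.degree 2 i - ((TableauPair.content 2 i 0 : ℤ) - ((TableauPair.content 2 i 0 : ℤ) - (TableauPair.content 2 i 1 : ℤ)) ^ 2) : ℤ) : ℝ) / Real.sqrt (n : ℝ)))) ≤ 2 * (n.factorial : ℝ) * Real.exp (C * θ ^ 2 * Real.sqrt (n : ℝ))) → Summit.MatrixMultiplication.MatrixMultiplication.Theses.SnSubsetDichotomy.NoThresholdSubsetTriple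 :=
  fun hK hM => noThresholdSubsetTriple_of_klr_pairDeviation hK (pairDeviation_of_mgf hM)

set_option linter.dupNamespace false in -- deliberate Summit.<S>.<P> duplicate
/-- **K3 ∧ MOMENTS ⟹ crux.** If `𝔽_p[S_n]` has the Hu–Mathas graded block basis and the even
moments of `X − w` (`X = deg₂ S + deg₂ T`, `w` the `2`-weight) over the same-shape pairs grow
sub-Gaussianly on the scale `n^{3/4}` uniformly up to the order `√n` —
`∑ (X − w)^{2k} ≤ n!·(Ck)^k·√n^{3k}` for all `1 ≤ k`, `k² ≤ n` and all large `n` — then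
`NoThresholdSubsetTriple` holds. Composition of `pairDeviation_of_moments` (Markov at
`k ≍ √n`) with `noThresholdSubsetTriple_of_klr_pairDeviation`. [folklore] -/
theorem noThresholdSubsetTriple_of_klr_moments : Literature.RepresentationTheory.FiniteGroups.KLRGradedCellularBasis → (∃ C : ℝ, 0 < C ∧ ∃ n₀ : ℕ, ∀ n ≥ n₀, ∀ k : ℕ, 1 ≤ k → k ^ 2 ≤ n → ∑ i : TableauPair n, ((TableauPair.degree 2 i - ((TableauPair.content 2 i 0 : ℤ) - ((TableauPair.content 2 i 0 : ℤ) - (TableauPair.content 2 i 1 : ℤ)) ^ 2) : ℤ) : ℝ) ^ (2 * k) ≤ (n.factorial : ℝ) * (C * k) ^ k * Real.sqrt (n : ℝ) ^ (3 * k)) → Summit.MatrixMultiplication.MatrixMultiplication.Theses.SnSubsetDichotomy.NoThresholdSubsetTriple :=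
  fun hK hM => noThresholdSubsetTriple_of_klr_pairDeviation hK (pairDeviation_of_moments hM)

end Summit.MatrixMultiplication.MatrixMultiplication.Theorems
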